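import Literature.NumberTheory.Automorphic.Liu2021.AppendixC.RecordCurveSec42Datum
import Literature.AlgebraicGeometry.ShimuraVarieties.UnitaryShimuraCurveLevelQuotient
import Literature.AlgebraicGeometry.Motives.SepQuotientIntermediateFibres
import Literature.NumberTheory.Automorphic.Liu2021.AppendixC.RestOneLevelInvariants
import Literature.NumberTheory.Automorphic.Liu2021.AppendixC.SmallLevelTrace
import HarnessLib

/-!
# HECKE-PRESENTATION on the record of the unitary Shimura curve: a clause quantified over ALL presentations of the right
# `t₁`∕`t₂`-translates of a point holds as soon as it holds at ONE level (Milne 2005 §5 ∕ Thm. 13.6; Deligne 1979 2.7.1 (c))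

Topic `NumberTheory/Automorphic/Liu2021/AppendixC`; namespace `Literature.NumberTheory.Automorphic.Liu2021.AppendixC`.  PROOF FILE
(theorems only: no definition, no instance, no notation, no named fact, no `sorry`) over ★ `RecordCurveSec42Datum` (the record՚s chosen
translates `recordHeckeTranslateGS`, `isHeckeTranslate_recordHeckeTranslateGS`), ★ `UnitaryShimuraCurveLevelQuotient`
(`RecordSystemGS.isLevelQuotient_of_heckeTranslateDefinedOver`: the levels are quotients of one another), ★ `SepQuotientIntermediateFibres`
(`IsSepQuotient.surjective_map_geometric_of_finiteIndex`: a separated quotient is onto on geometric points), ★ `RestOneLevelInvariants` ∕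
★ `SmallLevelTrace` (small-level bookkeeping).  Cell `hodgecm-mathlib` (D-0151), programme P6 «MOD» (crux hLiu418 = stmt-HodgeConjecture-24832,
`--supports`): GEN-glue for the letter `stub_RGD` of `Cruxes/HLiu418/Lines/F0_P6a_ModuliDatum.lean`.  HONEST LABEL: HC_CM is proved only modulo the
2 remaining named inputs (hLiu418 24832, h413 24833) — behind them the booked printed statements + the MOD package — until rung 0 closes; this
file is count-neutral capital.

## What, and why
The (c1) `hecke` field of the P6 isogeny dictionary (`Cruxes/HLiu418/Lines/F0_P6c_IsogenyDictionary.lean`, `PointDictionary.hecke`; = the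
field `ModuliDatum.hecke` of the P6a moduli datum) quantifies over EVERY presentation of the right-`t₁`- and `t₂`-translates of a point
`y ∈ M⋆_{Kc}(Ω)`: every source level `N′ ≤ Kc`, every pair of systems of coset representatives `rc₁ : Kc·t₁Kc ⁄ Kc → G`,
`rc₂ : Kc·t₂Kc ⁄ Kc → G` admissible at `N′` (`C5.HeckeLE (rc β) N′ Kc`), and every lift `x′ ∈ M⋆_{N′}(Ω)` of `y`, asking for a bijection
`e : Kc·t₁Kc ⁄ Kc ≃ Line y` with `T_{rc₁ β} x′ = quotΩ y (e β)` and `T_{rc₂ β₂} x′ = translΩ y`.  Whoever CONSTRUCTS a datum proves the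
coset ↔ line bijection against ONE presentation; **`hecke_of_hecke_at_level`** supplies the passage to all of them, on the RECORD side only
(no moduli, no integral model; `Line`, `quotΩ`, `translΩ` abstract).

THE ARGUMENT ([Milne2005ShimuraVarieties] §5 «`Sh_K = Sh_{K′}/(K/K′)`», Thm. 13.6; [Deligne1979ShimuraVarieties] 2.1.2–2.1.4, 2.7.1 (c)).
Given `(N′, rc₁, rc₂, x′)` and the reference presentation `(N₀, rd₁, rd₂)`: take a level `N″ ≤ N′ ⊓ N₀` normalised by `Kc`
(★ `C5.SmallLevel.exists_le_le` + `exists_normal_le`), lift `x′` to `x″ ∈ M⋆_{N″}(Ω)` (§0 `exists_algPoints_map_eq_of_normal`: the level map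
`M⋆_{N″} → M⋆_{N′}` is a quotient by the finite group `N′∕N″`, hence onto on `Ω`-points), and put `x₀ := u_{N″→N₀} x″`.  Since `rc₁ β` and
`rd₁ β` represent the SAME coset `β`, the composites `T_{rc₁ β} ∘ u_{N″→N′}` and `T_{rd₁ β} ∘ u_{N″→N₀}` are Hecke translates
`M⋆_{N″} → M⋆_{Kc}` by elements of one `Kc`-coset, hence EQUAL (GS-2b uniqueness ★ `RecordSystemGS.heckeTranslate_unique`; §1) — so the
bijection `e` of the reference presentation at `x₀` serves verbatim at `x′` (both lie over the same `y`).

* §0 `exists_algPoints_map_eq_of_normal` — lift of a geometric point along `M⋆_{N′} → M⋆_N` for `N′ ≤ N` normalised by `N` (the Body line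
  `Cruxes/HLiu418/Lines/F0D9opRoad2Body.lean` carries an inlined twin `RecordLemmas.exists_map_eq_of_normal` pending this Literature filing).
* §1 `map_recordHeckeTranslateGS_eq_of_coset_eq` — translates from two source levels by representatives of one `Kc`-coset agree on a
  common deeper level.
* §2 **`hecke_of_hecke_at_level`** — the head, generic in `t₁ t₂ : G`, in the abstract carriers `Line`, `quotΩ`, `translΩ`, and in the
  algebraically closed `F`-field `Ω`; conclusion = the `hecke` field type with `N′ … x′` as binders.

## References
* [Milne2005ShimuraVarieties] J. S. Milne, *Introduction to Shimura varieties* (2005), §5 p. 57 L7–12, Rem. 5.29 (c) p. 65, Thm. 13.6 p. 118.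
* [Deligne1979ShimuraVarieties] P. Deligne, *Variétés de Shimura*, PSPM XXXIII.2 (1979), 2.1.2–2.1.4, 2.7.1 (c).
* [SGA1] A. Grothendieck, *Revêtements étales et groupe fondamental*, Exp. V §1 Prop. 1.1.
* [Liu2021] Y. Liu, *Fourier–Jacobi cycles and arithmetic relative trace formula*, Camb. J. Math. 9 (2021), §4.2 l. 2060–2074, Prop. D.8 (1) p. 135.
-/

set_option autoImplicit false

open CategoryTheory _root_.NumberField _root_.IsDedekindDomain _root_.MulAction _root_.AlgebraicGeometry
open Literature.AlgebraicGeometry.Motives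
open Literature.AlgebraicGeometry.ShimuraVarieties.UnitaryCanonicalModel
open Literature.NumberTheory.Automorphic Literature.NumberTheory.Automorphic.UnitaryGroup

namespace Literature.NumberTheory.Automorphic.Liu2021.AppendixC

variable {F : Type} [Field F] [NumberField F] [IsCMField F] {Jstar : Matrix (Fin 2) (Fin 2) F} {ι₁ : F →+* ℂ}
  {K₀ : C5.OpenCompactSubgroup ↥(finAdelic ↥(maximalRealSubfield F) F (IsCMField.complexConj F) 2 Jstar)}
  (S : RecordSystemGS F Jstar ι₁ K₀)

/-! ### §0 Lift of a geometric point to a deeper normal level -/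

/-- **Lift of a geometric point to a deeper normal level**: for small levels `N′ ≤ N` with `N′` normalised by `N` and a level-quotient record
(`hLQ`, ★ `RecordSystemGS.isLevelQuotient_of_heckeTranslateDefinedOver`), every `Ω`-point of `M⋆_N` (`Ω ⊇ F` algebraically closed) lifts
along `u : M⋆_{N′} → M⋆_N` — `u` is a quotient of the projective `M⋆_{N′}` by the finite group `N∕N′` for separated test objects, hence onto
on geometric points (★ `IsSepQuotient.surjective_map_geometric_of_finiteIndex`). [cite: SGA1, Exp. V §1 Prop. 1.1]
[cite: Milne2005ShimuraVarieties, §5 p. 57 L7–12 and Rem. 5.29 (c) p. 65] -/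
theorem exists_algPoints_map_eq_of_normal (hLQ : S.IsLevelQuotient) {Ω : Type} [Field Ω] [Algebra F Ω] [IsAlgClosed Ω]
    {N' N : C5.SmallLevel K₀} (hN'N : N' ≤ N) (hn : ∀ k ∈ N.1.1, C5.HeckeLE k N' N') (x : AlgPoints (S.M.obj N) Ω) :
    ∃ x' : AlgPoints (S.M.obj N') Ω, AlgPoints.map (S.M.map (homOfLE hN'N)) x' = x := by
  obtain ⟨actN, hactN'⟩ := hLQ hN'N (fun k hk n hn' => hn k hk n hn')
  haveI := C5.SmallLevel.normal_subgroupOf_of_heckeLE N' N hn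
  haveI := C5.SmallLevel.finiteIndex_subgroupOf N' N
  have hXN' : IsProjectiveOver (S.M.obj N') := S.projective N'
  haveI : IsProper (S.M.obj N).hom := (S.projective N).isProper
  have hker : ∀ n ∈ (N'.1.1 : Subgroup ↥(finAdelic ↥(maximalRealSubfield F) F (IsCMField.complexConj F) 2 Jstar)).subgroupOf N.1.1,
      actN n = 1 := fun n hn' =>
    RecordSystemGS.IsLevelQuotient.act_eq_one_of_mem hactN'.1 n (Subgroup.mem_subgroupOf.1 hn')
  obtain ⟨x'', hx''⟩ := IsSepQuotient.surjective_map_geometric_of_finiteIndex (algebraMap F Ω) actN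
    ((N'.1.1 : Subgroup ↥(finAdelic ↥(maximalRealSubfield F) F (IsCMField.complexConj F) 2 Jstar)).subgroupOf N.1.1)
    (S.M.map (homOfLE hN'N)) hXN' inferInstance hker hactN'.2 x
  exact ⟨x'', hx''⟩

/-! ### §1 Translates by representatives of one `Kc`-coset agree on a common deeper level -/

/-- **Translates by two representatives of the same `Kc`-coset, from two source levels, agree on a common deeper level**:
for `N″ ≤ N′`, `N″ ≤ N₀`, `r Kc = r₀ Kc`, `T_r : M⋆_{N′} → M⋆_{Kc}` and `T_{r₀} : M⋆_{N₀} → M⋆_{Kc}` the record՚s chosen translates,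
`T_r (u_{N″→N′} x″) = T_{r₀} (u_{N″→N₀} x″)` — both composites are Hecke translates `M⋆_{N″} → M⋆_{Kc}` by elements of one
`Kc`-coset (GS-2b uniqueness ★ `RecordSystemGS.heckeTranslate_unique`). [cite: Milne2005ShimuraVarieties, Thm. 13.6 p. 118]
[cite: Deligne1979ShimuraVarieties, 2.1.4] -/
theorem map_recordHeckeTranslateGS_eq_of_coset_eq (hU7ₛ : S.HeckeTranslateDefinedOver) {Ω : Type} [Field Ω] [Algebra F Ω]
    {N'' N' N₀ Kc : C5.SmallLevel K₀} (h' : N'' ≤ N') (h₀ : N'' ≤ N₀)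
    {r r₀ : ↥(finAdelic ↥(maximalRealSubfield F) F (IsCMField.complexConj F) 2 Jstar)}
    (hcoset : ((r : ↥(finAdelic ↥(maximalRealSubfield F) F (IsCMField.complexConj F) 2 Jstar)) :
        ↥(finAdelic ↥(maximalRealSubfield F) F (IsCMField.complexConj F) 2 Jstar) ⧸
          (Kc.1.1 : Subgroup ↥(finAdelic ↥(maximalRealSubfield F) F (IsCMField.complexConj F) 2 Jstar))) =
      ((r₀ : ↥(finAdelic ↥(maximalRealSubfield F) F (IsCMField.complexConj F) 2 Jstar)) :
        ↥(finAdelic ↥(maximalRealSubfield F) F (IsCMField.complexConj F) 2 Jstar) ⧸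
          (Kc.1.1 : Subgroup ↥(finAdelic ↥(maximalRealSubfield F) F (IsCMField.complexConj F) 2 Jstar))))
    (hr : C5.HeckeLE r N' Kc) (hr₀ : C5.HeckeLE r₀ N₀ Kc) (x'' : AlgPoints (S.M.obj N'') Ω) :
    AlgPoints.map (recordHeckeTranslateGS S hU7ₛ r N' Kc hr) (AlgPoints.map (S.M.map (homOfLE h')) x'') =
      AlgPoints.map (recordHeckeTranslateGS S hU7ₛ r₀ N₀ Kc hr₀) (AlgPoints.map (S.M.map (homOfLE h₀)) x'') := by
  have hmem : r₀⁻¹ * r ∈ Kc.1.1 := QuotientGroup.eq.1 hcoset.symm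
  have h₁ : S.IsHeckeTranslate N'' Kc (1 * r) (S.M.map (homOfLE h') ≫ recordHeckeTranslateGS S hU7ₛ r N' Kc hr) :=
    S.isHeckeTranslate_comp (S.isHeckeTranslate_one_map (homOfLE h'))
      (isHeckeTranslate_recordHeckeTranslateGS S hU7ₛ r N' Kc hr)
  have h₂ : S.IsHeckeTranslate N'' Kc (1 * r₀ * (r₀⁻¹ * r))
      ((S.M.map (homOfLE h₀) ≫ recordHeckeTranslateGS S hU7ₛ r₀ N₀ Kc hr₀) ≫ 𝟙 _) :=
    S.isHeckeTranslate_comp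
      (S.isHeckeTranslate_comp (S.isHeckeTranslate_one_map (homOfLE h₀))
        (isHeckeTranslate_recordHeckeTranslateGS S hU7ₛ r₀ N₀ Kc hr₀))
      (S.isHeckeTranslate_id_of_mem Kc hmem)
  rw [one_mul] at h₁
  rw [one_mul, mul_inv_cancel_left, Category.comp_id] at h₂
  rw [← AlgPoints.map_comp_apply, ← AlgPoints.map_comp_apply, S.heckeTranslate_unique h₁ h₂]

/-! ### §2 The head: (c1) for every presentation from (c1) at one level -/

set_option maxHeartbeats 400000 in -- large adelic ∕ Shimura-set binder types (as the P6a Defs structure)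
/-- **HECKE-PRESENTATION — `hecke_of_hecke_at_level`.**  Let `S` be a curve record with Hecke translates over `F` (`hU7ₛ`), `Kc` a
small level, `t₁ t₂ ∈ G(𝔸_{F⁺,f})`, and `Line`, `quotΩ`, `translΩ` ANY carriers on `M⋆_{Kc}(Ω)` (`Ω ⊇ F` algebraically closed).  If the
(c1) clause holds at ONE presentation — a level `N₀ ≤ Kc` with representative systems `rd₁` of `Kc·t₁Kc ⁄ Kc` and `rd₂` of `Kc·t₂Kc ⁄ Kc`
admissible at `N₀`, for every `x₀ ∈ M⋆_{N₀}(Ω)` — then it holds at EVERY presentation `(N′, rc₁, rc₂, x′)`, with the conclusion spelled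
exactly as the field `PointDictionary.hecke` ∕ `ModuliDatum.hecke` (binders `N′ hN′Kc rc₁ _ hrcN₁ rc₂ _ hrcN₂ x′`).  The SAME bijection
`e` serves: `rc₁ β Kc = β = rd₁ β Kc`, so `T_{rc₁ β} x′ = T_{rd₁ β} x₀` on a common lift (§1), `x₀` and `x′` lying over the same `y`.
[cite: Milne2005ShimuraVarieties, §5 p. 57, Rem. 5.29 (c) p. 65, Thm. 13.6 p. 118] [cite: Deligne1979ShimuraVarieties, 2.7.1 (c)]
[cite: Liu2021, §4.2 l. 2060–2074; Prop. D.8 (1) p. 135] -/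
theorem hecke_of_hecke_at_level (hU7ₛ : S.HeckeTranslateDefinedOver) {Ω : Type} [Field Ω] [Algebra F Ω] [IsAlgClosed Ω]
    (Kc : C5.SmallLevel K₀) (t₁ t₂ : ↥(finAdelic ↥(maximalRealSubfield F) F (IsCMField.complexConj F) 2 Jstar))
    {Line : AlgPoints (S.M.obj Kc) Ω → Type*}
    (quotΩ : ∀ y, Line y → AlgPoints (S.M.obj Kc) Ω) (translΩ : AlgPoints (S.M.obj Kc) Ω → AlgPoints (S.M.obj Kc) Ω)
    (N₀ : C5.SmallLevel K₀) (hN₀Kc : N₀ ≤ Kc)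
    (rd₁ : orbit (Kc.1.1 : Subgroup ↥(finAdelic ↥(maximalRealSubfield F) F (IsCMField.complexConj F) 2 Jstar))
         ((t₁ : ↥(finAdelic ↥(maximalRealSubfield F) F (IsCMField.complexConj F) 2 Jstar)) :
           ↥(finAdelic ↥(maximalRealSubfield F) F (IsCMField.complexConj F) 2 Jstar) ⧸
             (Kc.1.1 : Subgroup ↥(finAdelic ↥(maximalRealSubfield F) F (IsCMField.complexConj F) 2 Jstar))) →
       ↥(finAdelic ↥(maximalRealSubfield F) F (IsCMField.complexConj F) 2 Jstar))
    (hrd₁ : ∀ β, ((rd₁ β : ↥(finAdelic ↥(maximalRealSubfield F) F (IsCMField.complexConj F) 2 Jstar)) :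
        ↥(finAdelic ↥(maximalRealSubfield F) F (IsCMField.complexConj F) 2 Jstar) ⧸
          (Kc.1.1 : Subgroup ↥(finAdelic ↥(maximalRealSubfield F) F (IsCMField.complexConj F) 2 Jstar))) = β.1)
    (hrdN₁ : ∀ β, C5.HeckeLE (rd₁ β) N₀ Kc)
    (rd₂ : orbit (Kc.1.1 : Subgroup ↥(finAdelic ↥(maximalRealSubfield F) F (IsCMField.complexConj F) 2 Jstar))
         ((t₂ : ↥(finAdelic ↥(maximalRealSubfield F) F (IsCMField.complexConj F) 2 Jstar)) :
           ↥(finAdelic ↥(maximalRealSubfield F) F (IsCMField.complexConj F) 2 Jstar) ⧸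
             (Kc.1.1 : Subgroup ↥(finAdelic ↥(maximalRealSubfield F) F (IsCMField.complexConj F) 2 Jstar))) →
       ↥(finAdelic ↥(maximalRealSubfield F) F (IsCMField.complexConj F) 2 Jstar))
    (hrd₂ : ∀ β, ((rd₂ β : ↥(finAdelic ↥(maximalRealSubfield F) F (IsCMField.complexConj F) 2 Jstar)) :
        ↥(finAdelic ↥(maximalRealSubfield F) F (IsCMField.complexConj F) 2 Jstar) ⧸
          (Kc.1.1 : Subgroup ↥(finAdelic ↥(maximalRealSubfield F) F (IsCMField.complexConj F) 2 Jstar))) = β.1)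
    (hrdN₂ : ∀ β, C5.HeckeLE (rd₂ β) N₀ Kc)
    (h₀ : ∀ x₀ : AlgPoints (S.M.obj N₀) Ω,
      ∃ e : (orbit (Kc.1.1 : Subgroup ↥(finAdelic ↥(maximalRealSubfield F) F (IsCMField.complexConj F) 2 Jstar))
         ((t₁ : ↥(finAdelic ↥(maximalRealSubfield F) F (IsCMField.complexConj F) 2 Jstar)) :
           ↥(finAdelic ↥(maximalRealSubfield F) F (IsCMField.complexConj F) 2 Jstar) ⧸
             (Kc.1.1 : Subgroup ↥(finAdelic ↥(maximalRealSubfield F) F (IsCMField.complexConj F) 2 Jstar)))) ≃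
          Line (AlgPoints.map (S.M.map (homOfLE hN₀Kc)) x₀),
        (∀ β, AlgPoints.map (recordHeckeTranslateGS S hU7ₛ (rd₁ β) N₀ Kc (hrdN₁ β)) x₀ =
            quotΩ (AlgPoints.map (S.M.map (homOfLE hN₀Kc)) x₀) (e β)) ∧
        ∀ β₂, AlgPoints.map (recordHeckeTranslateGS S hU7ₛ (rd₂ β₂) N₀ Kc (hrdN₂ β₂)) x₀ =
            translΩ (AlgPoints.map (S.M.map (homOfLE hN₀Kc)) x₀))
    (N' : C5.SmallLevel K₀) (hN'Kc : N' ≤ Kc)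
    (rc₁ : orbit (Kc.1.1 : Subgroup ↥(finAdelic ↥(maximalRealSubfield F) F (IsCMField.complexConj F) 2 Jstar))
         ((t₁ : ↥(finAdelic ↥(maximalRealSubfield F) F (IsCMField.complexConj F) 2 Jstar)) :
           ↥(finAdelic ↥(maximalRealSubfield F) F (IsCMField.complexConj F) 2 Jstar) ⧸
             (Kc.1.1 : Subgroup ↥(finAdelic ↥(maximalRealSubfield F) F (IsCMField.complexConj F) 2 Jstar))) →
       ↥(finAdelic ↥(maximalRealSubfield F) F (IsCMField.complexConj F) 2 Jstar))
    (hrc₁ : ∀ β, ((rc₁ β : ↥(finAdelic ↥(maximalRealSubfield F) F (IsCMField.complexConj F) 2 Jstar)) :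
        ↥(finAdelic ↥(maximalRealSubfield F) F (IsCMField.complexConj F) 2 Jstar) ⧸
          (Kc.1.1 : Subgroup ↥(finAdelic ↥(maximalRealSubfield F) F (IsCMField.complexConj F) 2 Jstar))) = β.1)
    (hrcN₁ : ∀ β, C5.HeckeLE (rc₁ β) N' Kc)
    (rc₂ : orbit (Kc.1.1 : Subgroup ↥(finAdelic ↥(maximalRealSubfield F) F (IsCMField.complexConj F) 2 Jstar))
         ((t₂ : ↥(finAdelic ↥(maximalRealSubfield F) F (IsCMField.complexConj F) 2 Jstar)) :
           ↥(finAdelic ↥(maximalRealSubfield F) F (IsCMField.complexConj F) 2 Jstar) ⧸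
             (Kc.1.1 : Subgroup ↥(finAdelic ↥(maximalRealSubfield F) F (IsCMField.complexConj F) 2 Jstar))) →
       ↥(finAdelic ↥(maximalRealSubfield F) F (IsCMField.complexConj F) 2 Jstar))
    (hrc₂ : ∀ β, ((rc₂ β : ↥(finAdelic ↥(maximalRealSubfield F) F (IsCMField.complexConj F) 2 Jstar)) :
        ↥(finAdelic ↥(maximalRealSubfield F) F (IsCMField.complexConj F) 2 Jstar) ⧸
          (Kc.1.1 : Subgroup ↥(finAdelic ↥(maximalRealSubfield F) F (IsCMField.complexConj F) 2 Jstar))) = β.1)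
    (hrcN₂ : ∀ β, C5.HeckeLE (rc₂ β) N' Kc)
    (x' : AlgPoints (S.M.obj N') Ω) :
    ∃ e : (orbit (Kc.1.1 : Subgroup ↥(finAdelic ↥(maximalRealSubfield F) F (IsCMField.complexConj F) 2 Jstar))
         ((t₁ : ↥(finAdelic ↥(maximalRealSubfield F) F (IsCMField.complexConj F) 2 Jstar)) :
           ↥(finAdelic ↥(maximalRealSubfield F) F (IsCMField.complexConj F) 2 Jstar) ⧸
             (Kc.1.1 : Subgroup ↥(finAdelic ↥(maximalRealSubfield F) F (IsCMField.complexConj F) 2 Jstar)))) ≃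
          Line (AlgPoints.map (S.M.map (homOfLE hN'Kc)) x'),
      (∀ β, AlgPoints.map (recordHeckeTranslateGS S hU7ₛ (rc₁ β) N' Kc (hrcN₁ β)) x' =
          quotΩ (AlgPoints.map (S.M.map (homOfLE hN'Kc)) x') (e β)) ∧
      ∀ β₂, AlgPoints.map (recordHeckeTranslateGS S hU7ₛ (rc₂ β₂) N' Kc (hrcN₂ β₂)) x' =
          translΩ (AlgPoints.map (S.M.map (homOfLE hN'Kc)) x') := by
  have hLQ : S.IsLevelQuotient := RecordSystemGS.isLevelQuotient_of_heckeTranslateDefinedOver S hU7ₛ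
  have hN'Kc' : (N'.1.1 : Subgroup ↥(finAdelic ↥(maximalRealSubfield F) F (IsCMField.complexConj F) 2 Jstar)) ≤ Kc.1.1 :=
    hN'Kc
  -- a common level `N″ ≤ N′ ⊓ N₀` normalised by `Kc`
  obtain ⟨L, hLN', hLN₀⟩ := C5.SmallLevel.exists_le_le N' N₀
  obtain ⟨N'', -, hN''L, hn''⟩ := C5.SmallLevel.exists_normal_le Kc L
  have hN''N' : N'' ≤ N' := hN''L.trans hLN'
  have hN''N₀ : N'' ≤ N₀ := hN''L.trans hLN₀
  -- lift `x′` to `x″ ∈ M⋆_{N″}(Ω)`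
  obtain ⟨x'', hx''⟩ :=
    exists_algPoints_map_eq_of_normal S hLQ hN''N' (fun k hk => hn'' k (hN'Kc' hk)) x'
  subst hx''
  -- `x₀ := u_{N″→N₀} x″` lies over the same `y`
  have hy : AlgPoints.map (S.M.map (homOfLE hN₀Kc)) (AlgPoints.map (S.M.map (homOfLE hN''N₀)) x'') =
      AlgPoints.map (S.M.map (homOfLE hN'Kc)) (AlgPoints.map (S.M.map (homOfLE hN''N')) x'') := by
    rw [← AlgPoints.map_comp_apply, ← AlgPoints.map_comp_apply, ← Functor.map_comp, ← Functor.map_comp]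
    rfl
  -- the reference presentation at `x₀`, transported along `hy`
  suffices key : ∀ y : AlgPoints (S.M.obj Kc) Ω,
      AlgPoints.map (S.M.map (homOfLE hN₀Kc)) (AlgPoints.map (S.M.map (homOfLE hN''N₀)) x'') = y →
      ∃ e : (orbit (Kc.1.1 : Subgroup ↥(finAdelic ↥(maximalRealSubfield F) F (IsCMField.complexConj F) 2 Jstar))
           ((t₁ : ↥(finAdelic ↥(maximalRealSubfield F) F (IsCMField.complexConj F) 2 Jstar)) :
             ↥(finAdelic ↥(maximalRealSubfield F) F (IsCMField.complexConj F) 2 Jstar) ⧸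
               (Kc.1.1 : Subgroup ↥(finAdelic ↥(maximalRealSubfield F) F (IsCMField.complexConj F) 2 Jstar)))) ≃ Line y,
        (∀ β, AlgPoints.map (recordHeckeTranslateGS S hU7ₛ (rc₁ β) N' Kc (hrcN₁ β))
              (AlgPoints.map (S.M.map (homOfLE hN''N')) x'') = quotΩ y (e β)) ∧
        ∀ β₂, AlgPoints.map (recordHeckeTranslateGS S hU7ₛ (rc₂ β₂) N' Kc (hrcN₂ β₂))
              (AlgPoints.map (S.M.map (homOfLE hN''N')) x'') = translΩ y from
    key _ hy
  intro y hyy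
  subst hyy
  obtain ⟨e, he₁, he₂⟩ := h₀ (AlgPoints.map (S.M.map (homOfLE hN''N₀)) x'')
  refine ⟨e, fun β => ?_, fun β₂ => ?_⟩
  · rw [← he₁ β]
    exact map_recordHeckeTranslateGS_eq_of_coset_eq S hU7ₛ hN''N' hN''N₀ ((hrc₁ β).trans (hrd₁ β).symm)
      (hrcN₁ β) (hrdN₁ β) x''
  · rw [← he₂ β₂]
    exact map_recordHeckeTranslateGS_eq_of_coset_eq S hU7ₛ hN''N' hN''N₀ ((hrc₂ β₂).trans (hrd₂ β₂).symm)
      (hrcN₂ β₂) (hrdN₂ β₂) x''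

end Literature.NumberTheory.Automorphic.Liu2021.AppendixC
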